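import Summits.QuantumAdvantage.QuantumAdvantage.Theses.ArithStatLadder
import Summits.QuantumAdvantage.QuantumAdvantage.Theorems.ArithStatLadderIqThreeNotPPoly
import Summits.QuantumAdvantage.QuantumAdvantage.Theorems.ArithStatLadderIqThreeNotPPolyStubSamplerNG
import Summits.QuantumAdvantage.QuantumAdvantage.Theorems.ArithStatLadderIqThreeNotPPolyStubOneSidedNG
import Summits.QuantumAdvantage.QuantumAdvantage.Theorems.ArithStatLadderIqThreeNotPPolyStubNagellHit
import Summits.QuantumAdvantage.QuantumAdvantage.Theorems.ArithStatLadderIqThreeNotPPolyStubFundDensityNG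
import Literature.Computability.Cryptography.HallgrenClassGroup
import Literature.Computability.Complexity.StackWords

/-!
# Line `Sketch` (skeleton v4, gen-1 lead) for the crux `ArithStatLadder.IqThreeNotPPoly` (stmt-QuantumAdvantage-2422)

SQUAREFREE-FILTER DOMINATION, reshaped by the gen-1 lead `prover-line-stmt-QuantumAdvantage-2422-1`:
the class-field-theory socket of v3 (Hasse 1930: a cubic field of fundamental discriminant `−d`
forces `3 ∣ h(−d)`, named fact `Hasse1930_threeTorsion_dictionary_neg`, unproved in the tree) is
DELETED. The planted family of binary cubic forms is replaced by NAGELL's ELEMENTARY 3-TORSION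
(T. Nagell, Abh. Math. Sem. Hamburg 1 (1922), 140–150; cf. Cohen, GTM 138, Exercise 5.?; Soundararajan
2000 §1): on modulus `N` and seed `k` put

  `c = 1 + 2^30 N^5`,  `s = 1 + 6 c N k`,  `B = 2c³ − N s`,  `d = N s (4c³ − N s) = 4c⁶ − B² = 4a³ − B²`, `a = c²`.

If `−d` is fundamental then in `K = ℚ(√−d)` the ideal `𝔞 = (a, (B + √−d)/2)` (norm `a`) satisfies
`𝔞³ = ((B + √−d)/2)` (concordant composition; `gcd(a, B) = 1` because `c ≡ 1 (mod N)` and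
`s ≡ 1 (mod c)`), and `𝔞` is not principal (`4a < d`, so the elements of norm `a` are `±√a ∈ ℤ`, which
do not divide `(B + √−d)/2`); hence `Cl(K)` has an element of order `3` and `3 ∣ h(−d)`
(`stub_nagellHit`, the lead's stub; tree: form–ideal dictionary `FormIdeals*.lean`,
`card_reducedForms_eq_classNumber`, `exists_numberField_discr_eq`). The rest of the line is as in v3:
NO side exact (`p² ∣ N ⇒ p² ∣ d`, `4 ∣ N ⇒ 16 ∣ d`: `stub_oneSidedNG`); YES side by the LANDED
elementary AP squarefree sieve `stub_apSieve` (p89304) applied to the two progressions `s = 1 + 6cN·k`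
and `4c³ − N s` (reflected), both at `p₀ = 5`, residues automatic (`N` odd: `d ≡ 3 (mod 4)`; `N ≡ 2 (4)`:
`−d/4 ≡ 3 (mod 4)` as `c ≡ 1 (mod 4)`), density `≥ 1/4` for bit-length `n ≥ n₀` with seeds
`k < 2^{8n+48}` (`stub_fundDensityNG`); the sampler is an `FP` string function (`stub_samplerNG`); the
closure of `P/poly` under one-sided randomized reductions is LANDED (`mem_PPoly_of_rurReduction`,
p91021) as is the numeral guard (`stub_natAdapter`, p86414). With the apex `stub_sqfreeNotPPoly`
(hypothesis-type, factoring family, never staffed) the crux follows BY NAME (`IqThreeNotPPoly_of`), and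
WITHOUT the apex the refutation floor `¬X → SQF ∈ P/poly` becomes an UNCONDITIONAL theorem.

## Disproof used (`Cruxes/IqThreeNotPPoly/Disproof.lean`, cdisprove cycles 1–2, NO KILL)
* §0/§2: X is `IQ3 ∉ P/poly` verbatim; ¬X = explicit poly-size circuits for `3 ∣ h(−d)`. This line's
  contrapositive is the floor under every refutation; v4 makes it CFT-free.
* §3(a): the fundamentality conjunct bundles squarefree recognition — exactly the lever.
* §4(d): `h = 1` mutation false (finite language) — our YES instances have `3 ∣ h`, infinitely many
  (Nagell 1922 is the classical source of infinitely many `d` with `3 ∣ h(−d)`).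
* No `_false_without_` theorem; `-- Targets`: none.
-/

set_option linter.unusedVariables false
set_option linter.dupNamespace false

noncomputable section

namespace Summit.QuantumAdvantage.QuantumAdvantage.Cruxes.IqThreeNotPPoly.Sketch

open scoped Classical BigOperators
open _root_.Computability
open Literature.Computability.Complexity
open Literature.Computability.Cryptography (IsNegFundamentalDiscr)
open Literature.NumberTheory.QuadraticFields (BinaryQuadraticForm.classNumber)
open Summit.QuantumAdvantage.QuantumAdvantage.Theses.ArithStatLadder (IqThreeNotPPoly)
open Summit.QuantumAdvantage.QuantumAdvantage.Theorems.IqThreeNotPPoly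
  (stub_natAdapter stub_apSieve mem_PPoly_of_rurReduction card_filter_seeds
    encodeNat_mem_toLanguage_iff nil_not_mem_iqThreeLanguage not_isNegFundamentalDiscr_zero)

/-! ## Vocabulary (the crux's set verbatim; the Nagell family as abbreviations — stub signatures carry
the EXPANDED expressions, no new notion enters a stub signature) -/

/-- The crux's set `S = {d : −d fundamental, 3 ∣ h(−d)}`. -/
def iqThreeSet : Set ℕ :=
  {d : ℕ | IsNegFundamentalDiscr d ∧ 3 ∣ BinaryQuadraticForm.classNumber (-(d : ℤ))}

/-- `IQ3 = bin S`. -/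
def iqThreeLang : Language Bool := encodingNatBool.toLanguage iqThreeSet

/-- `SQF = bin {m : m squarefree}`. -/
def sqfreeLang : Language Bool := encodingNatBool.toLanguage {m : ℕ | Squarefree m}

/-- `c = 1 + 2^30 N^5` (odd, `≡ 1 (mod N)`, `≡ 1 (mod 4)`). -/
def ngC (N : ℕ) : ℕ := 1 + 2 ^ 30 * N ^ 5

/-- `s = 1 + 6 c N k` (odd, `≡ 1 (mod 3cN)`). -/
def ngS (N k : ℕ) : ℕ := 1 + 6 * (1 + 2 ^ 30 * N ^ 5) * N * k

/-- The sampler's output `d = N s (4c³ − N s)` (`= 4c⁶ − (2c³ − N s)²` when the subtraction does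
not truncate). -/
def ngD (N k : ℕ) : ℕ :=
  N * (1 + 6 * (1 + 2 ^ 30 * N ^ 5) * N * k) *
    (4 * (1 + 2 ^ 30 * N ^ 5) ^ 3 - N * (1 + 6 * (1 + 2 ^ 30 * N ^ 5) * N * k))

/-! ## The registered stubs (all CLOSED by landed files except the apex; the only `sorry` is the apex) -/

/-- **STUB E · `stub_samplerNG`** — CLOSED (p97086, `…StubSamplerNG.lean`) (the Nagell sampler is polynomial time): `⟨x, r⟩ ↦ bin d`,
`N = ⟦x⟧`, `k = ⟦r⟧`, `d = N s (4c³ − N s)` (truncated subtraction), is an `FP` string function. -/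
theorem stub_samplerNG :
    ∃ f : List Bool → List Bool, f ∈ FP ∧ ∀ x r : List Bool,
      f (boolPair x r) = encodeNat (bitsToNat x * (1 + 6 * (1 + 2 ^ 30 * bitsToNat x ^ 5) * bitsToNat x * bitsToNat r) *
        (4 * (1 + 2 ^ 30 * bitsToNat x ^ 5) ^ 3 -
          bitsToNat x * (1 + 6 * (1 + 2 ^ 30 * bitsToNat x ^ 5) * bitsToNat x * bitsToNat r))) :=
  Summit.QuantumAdvantage.QuantumAdvantage.Theorems.IqThreeNotPPoly.stub_samplerNG

/-- **STUB F · `stub_oneSidedNG`** — CLOSED (p97532, `…StubOneSidedNG.lean`) (ONE-SIDEDNESS, exact): a non-squarefree modulus never yields a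
negative fundamental discriminant (`p² ∣ N ⇒ p² ∣ d` for odd `p`; `4 ∣ N ⇒ 16 ∣ d`; `N = 0 ↦ d = 0`;
a truncated subtraction gives `d = 0`). -/
theorem stub_oneSidedNG :
    ∀ (N k : ℕ), ¬ Squarefree N →
      ¬ IsNegFundamentalDiscr (N * (1 + 6 * (1 + 2 ^ 30 * N ^ 5) * N * k) *
        (4 * (1 + 2 ^ 30 * N ^ 5) ^ 3 - N * (1 + 6 * (1 + 2 ^ 30 * N ^ 5) * N * k))) :=
  Summit.QuantumAdvantage.QuantumAdvantage.Theorems.IqThreeNotPPoly.stub_oneSidedNG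

/-- **STUB G · `stub_fundDensityNG`** — CLOSED (p102695, `…StubFundDensityNG.lean`) (YES-DENSITY `≥ 1/4`, from the landed `stub_apSieve`): for
squarefree `N` of bit-length `n ≥ n₀`, at least a quarter of the seeds `k < 2^{8n+48}` make `−d`
fundamental (`s = 1 + 6cNk` and `4c³ − N s`, resp. `2c³ − (N/2) s` for even `N`, squarefree suffice;
two progressions at `p₀ = 5`; the residues mod `4` are automatic). -/
theorem stub_fundDensityNG :
    ∃ n₀ : ℕ, ∀ n, n₀ ≤ n → ∀ N : ℕ, Squarefree N → (encodeNat N).length = n →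
      2 ^ (8 * n + 48) ≤ 4 * ((Finset.range (2 ^ (8 * n + 48))).filter (fun k =>
        IsNegFundamentalDiscr (N * (1 + 6 * (1 + 2 ^ 30 * N ^ 5) * N * k) *
          (4 * (1 + 2 ^ 30 * N ^ 5) ^ 3 - N * (1 + 6 * (1 + 2 ^ 30 * N ^ 5) * N * k))))).card :=
  Summit.QuantumAdvantage.QuantumAdvantage.Theorems.IqThreeNotPPoly.stub_fundDensityNG

/-- **STUB H · `stub_nagellHit`** — CLOSED (p98663, `…StubNagellHit.lean`) (NAGELL'S ELEMENTARY 3-TORSION; the lead's stub): whenever `−d` is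
fundamental, `d = N s (4c³ − N s) = 4a³ − B²` with `a = c² ≥ 4`, `gcd(a, B) = 1`, `4a < d`, and the
ideal `(a, (B + √−d)/2)` of `ℚ(√−d)` has order exactly `3` in the class group, so `3 ∣ h(−d)`. -/
theorem stub_nagellHit :
    ∀ (N k : ℕ),
      IsNegFundamentalDiscr (N * (1 + 6 * (1 + 2 ^ 30 * N ^ 5) * N * k) *
        (4 * (1 + 2 ^ 30 * N ^ 5) ^ 3 - N * (1 + 6 * (1 + 2 ^ 30 * N ^ 5) * N * k))) →
      3 ∣ BinaryQuadraticForm.classNumber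
        (-((N * (1 + 6 * (1 + 2 ^ 30 * N ^ 5) * N * k) *
          (4 * (1 + 2 ^ 30 * N ^ 5) ^ 3 - N * (1 + 6 * (1 + 2 ^ 30 * N ^ 5) * N * k)) : ℕ) : ℤ)) :=
  Summit.QuantumAdvantage.QuantumAdvantage.Theorems.IqThreeNotPPoly.stub_nagellHit

/-- **STUB X · `stub_sqfreeNotPPoly`** (THE APEX; hypothesis-type, crux-sized — separation strength,
never staffed; registered so that the composition concludes the crux by name). -/
theorem stub_sqfreeNotPPoly :
    encodingNatBool.toLanguage {m : ℕ | Squarefree m} ∉ PPoly := by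
  sorry

/-! ## Proved glue -/

/-- The crux is literally `IQ3 ∉ P/poly` (definitional). -/
theorem iqThreeNotPPoly_iff : IqThreeNotPPoly ↔ iqThreeLang ∉ PPoly := Iff.rfl

/-- `ngD` is the expanded expression of the stub signatures (definitional). -/
theorem ngD_eq (N k : ℕ) : ngD N k =
    N * (1 + 6 * (1 + 2 ^ 30 * N ^ 5) * N * k) *
      (4 * (1 + 2 ^ 30 * N ^ 5) ^ 3 - N * (1 + 6 * (1 + 2 ^ 30 * N ^ 5) * N * k)) := rfl

/-- Membership of a numeral in `IQ3`. -/
theorem encodeNat_mem_iqThreeLang_iff (d : ℕ) : encodeNat d ∈ iqThreeLang ↔ d ∈ iqThreeSet :=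
  encodingNatBool.mem_toLanguage_iff iqThreeSet d

/-- Membership of a numeral in `SQF`. -/
theorem encodeNat_mem_sqfreeLang_iff (m : ℕ) : encodeNat m ∈ sqfreeLang ↔ Squarefree m :=
  encodingNatBool.mem_toLanguage_iff {m : ℕ | Squarefree m} m

/-- The empty word is not in `IQ3`. -/
theorem nil_not_mem_iqThreeLang' : ([] : List Bool) ∉ iqThreeLang := nil_not_mem_iqThreeLanguage

/-- A fundamental seed lands in `S` (STUB H). -/
theorem ngD_mem_iqThreeSet (N k : ℕ) (hfund : IsNegFundamentalDiscr (ngD N k)) : ngD N k ∈ iqThreeSet :=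
  ⟨hfund, stub_nagellHit N k hfund⟩

/-! ## The composition: the stubs imply the crux, BY NAME -/

/-- **The RUR reduction `SQF ≤ IQ3`** from STUBS E, F, G, H and the landed guard / sieve / closure:
`IQ3 ∈ P/poly → SQF ∈ P/poly`. Seeds of length `ℓ(n) = 8n + 48`, success polynomial `q = 8 X + 48`. -/
theorem sqfreeLang_mem_PPoly_of_iqThree (hIQ : iqThreeLang ∈ PPoly) : sqfreeLang ∈ PPoly := by
  obtain ⟨f, hf, hfval⟩ := stub_samplerNG
  obtain ⟨f', hf', hcanon, hjunk⟩ := stub_natAdapter f hf []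
  obtain ⟨n₀, hdens⟩ := stub_fundDensityNG
  refine mem_PPoly_of_rurReduction sqfreeLang iqThreeLang f' hf' (fun n => 8 * n + 48)
    (8 * Polynomial.X + 48) n₀ (fun n => ?_) ?_ ?_ hIQ
  · simp only [Polynomial.eval_add, Polynomial.eval_mul, Polynomial.eval_ofNat, Polynomial.eval_X]
    omega
  · -- NO side (exact): non-squarefree numerals by STUB F, non-numerals by the guard
    intro x hx r
    by_cases hcx : ∃ m : ℕ, encodeNat m = x
    · obtain ⟨m, rfl⟩ := hcx
      have hm : ¬ Squarefree m := fun h => hx ((encodeNat_mem_sqfreeLang_iff m).2 h)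
      rw [hcanon, hfval, bitsToNat_encodeNat, encodeNat_mem_iqThreeLang_iff]
      rintro ⟨hfund, -⟩
      exact stub_oneSidedNG m (bitsToNat r) hm hfund
    · rw [hjunk x r (fun m hm => hcx ⟨m, hm⟩)]
      exact nil_not_mem_iqThreeLang'
  · -- YES side (density ≥ 1/4): STUB G, and fundamental seeds are in `S` by STUB H
    intro x hx hn
    obtain ⟨N, hN, hNx⟩ := hx
    change encodeNat N = x at hNx
    subst hNx
    have hsq : Squarefree N := hN
    have h := hdens (encodeNat N).length hn N hsq rfl
    have hq : 4 ≤ (8 * Polynomial.X + 48 : Polynomial ℕ).eval (encodeNat N).length := by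
      simp only [Polynomial.eval_add, Polynomial.eval_mul, Polynomial.eval_ofNat, Polynomial.eval_X]
      omega
    refine h.trans ((Nat.mul_le_mul_right _ hq).trans (Nat.mul_le_mul_left _ ?_))
    change ((Finset.range (2 ^ (8 * (encodeNat N).length + 48))).filter
      (fun k => IsNegFundamentalDiscr (ngD N k))).card ≤ _
    rw [← card_filter_seeds (8 * (encodeNat N).length + 48) (fun k => IsNegFundamentalDiscr (ngD N k))]
    refine Finset.card_le_card fun r hr => ?_
    rw [Finset.mem_filter] at hr ⊢
    refine ⟨Finset.mem_univ _, ?_⟩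
    rw [hcanon, hfval, bitsToNat_encodeNat, encodeNat_mem_iqThreeLang_iff]
    exact ngD_mem_iqThreeSet N _ hr.2

/-- **`IqThreeNotPPoly_of`** — the registered stubs give the crux BY NAME: if `IQ3 ∈ P/poly` then
`SQF ∈ P/poly` (`sqfreeLang_mem_PPoly_of_iqThree`), contradicting the apex `stub_sqfreeNotPPoly`. -/
theorem IqThreeNotPPoly_of :
    Summit.QuantumAdvantage.QuantumAdvantage.Theses.ArithStatLadder.IqThreeNotPPoly := by
  rw [iqThreeNotPPoly_iff]
  intro hIQ
  exact stub_sqfreeNotPPoly (sqfreeLang_mem_PPoly_of_iqThree hIQ)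

/-! ## By-product for the negative side (no apex): the refutation floor, now CFT-free -/

/-- **The refutation floor**: any refutation of the crux puts SQUAREFREES in `P/poly` — from STUBS
E, F, G, H only (the apex is not used; no class field theory). -/
theorem sqfree_mem_PPoly_of_not (h : ¬ IqThreeNotPPoly) : sqfreeLang ∈ PPoly :=
  sqfreeLang_mem_PPoly_of_iqThree (not_not.1 ((not_congr iqThreeNotPPoly_iff).1 h))

end Summit.QuantumAdvantage.QuantumAdvantage.Cruxes.IqThreeNotPPoly.Sketch

end
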